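import Literature.NumberTheory.DiophantineApproximation.PolylogTwoPointLinearIndependenceRational
import Literature.NumberTheory.DiophantineApproximation.PolylogTwoPointParity
import HarnessLib

/-!
# Linear independence of `1, Li_s(M/N), Li_s(−M/N)` (`s ≤ w`) over `ℚ` for
`log N ≥ 4 (w+1)³ + 4 w log M`

Topic `Literature/NumberTheory/DiophantineApproximation`. The TWO-POINT case of
David–Hirata-Kohno–Kawashima 2020, Thm 2.1 at the RATIONAL points `±M/N` (`K = ℚ`, `x = 0`, `m = 2`,
`α = (M, −M)`, `β = N`), PROVED with a crude threshold: for every weight `w ≥ 1`, every `M ≥ 1` and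
every integer `N` with `log N ≥ 4 (w+1)³ + 4 w log M` the `2w + 1` numbers `1, Li_s(M/N), Li_s(−M/N)`
(`1 ≤ s ≤ w`, `Li_s = DilogPade.polylogSeries s`) are linearly independent over `ℚ`
(`one_polylog_twoPoints_linearIndependent_rat`; the integer-point case `M = 1` is
`one_polylog_twoPoints_linearIndependent`, `PolylogTwoPointsLinearIndependence.lean`).

The reduction is the parity bridge at a rational point: with `y = M²/N²`,

* `ParityPade.polylogSeries_div_eq` — `Li_s(M/N) = 2^{-s} Li_s(M²/N²) + (N/M) Θ_s(M²/N²)`;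
* `ParityPade.polylogSeries_neg_div_eq` — `Li_s(−M/N) = 2^{-s} Li_s(M²/N²) − (N/M) Θ_s(M²/N²)`

(`Θ_s = ParityPade.oddPolylogSeries s`; split `Li_s(x) = ∑_{k ≥ 0} x^{k+1}/(k+1)^s`, `x = ±M/N`,
into even and odd `k` with `tsum_even_add_odd`: for `k = 2j` the term is
`x^{2j+1}/(2j+1)^s = ± (N/M) y^{j+1}/(2j+1)^s`, for `k = 2j+1` it is `y^{j+1}/(2^s (j+1)^s)`).
It turns a rational relation among `1, Li_s(±M/N)` into one among `1, Li_s(M²/N²), Θ_s(M²/N²)` with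
coefficients `(b_s + c_s)/2^s`, `(b_s − c_s) N/M`, and those numbers are linearly independent over `ℚ`
for `log N² ≥ 8(w+1)³ + 4 w log M²` (`one_polylog_oddPolylog_linearIndependent_rat`,
`PolylogTwoPointLinearIndependenceRational.lean`).
-- TODO(general form): the threshold `V > 0` of [DavidHirataKohnoKawashima2020, Thm 2.1]; general
-- algebraic points `α`.

References: S. David, N. Hirata-Kohno, M. Kawashima, *Can polylogarithms at algebraic points be
linearly independent?*, Moscow J. Comb. Number Th. 9 (2020) 389–406, Thm 2.1.
-/

noncomputable section

open Finset

namespace Literature.NumberTheory.DiophantineApproximation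

namespace ParityPade

/-- The even-index terms of `Li_s(x)` (`x ≠ 0`): `x^{2j+1}/(2j+1)^s = x⁻¹ · (x²)^{j+1}/(2j+1)^s`.
[folklore] -/
private theorem ratParity_term_even (s : ℕ) {x : ℝ} (hx : x ≠ 0) (j : ℕ) :
    x ^ (2 * j + 1) / (((2 * j : ℕ) : ℝ) + 1) ^ s =
      x⁻¹ * ((x ^ 2) ^ (j + 1) / (2 * (j : ℝ) + 1) ^ s) := by
  have hj : 2 * (j + 1) = 2 * j + 1 + 1 := by ring
  have hc : ((2 * j : ℕ) : ℝ) + 1 = 2 * (j : ℝ) + 1 := by push_cast; ring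
  have h : x⁻¹ * (x ^ 2) ^ (j + 1) = x ^ (2 * j + 1) := by
    rw [← pow_mul, hj, pow_succ' _ (2 * j + 1), ← mul_assoc, inv_mul_cancel₀ hx, one_mul]
  rw [hc, ← mul_div_assoc, h]

/-- The odd-index terms of `Li_s(x)`: `x^{2j+2}/(2j+2)^s = ((x²)^{j+1}/(j+1)^s)/2^s`. [folklore] -/
private theorem ratParity_term_odd (s : ℕ) (x : ℝ) (j : ℕ) :
    x ^ (2 * j + 1 + 1) / (((2 * j + 1 : ℕ) : ℝ) + 1) ^ s =
      (x ^ 2) ^ (j + 1) / ((j : ℝ) + 1) ^ s / 2 ^ s := by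
  have h2 : ((2 * j + 1 : ℕ) : ℝ) + 1 = 2 * ((j : ℝ) + 1) := by push_cast; ring
  have hj : 2 * j + 1 + 1 = 2 * (j + 1) := by ring
  rw [h2, hj, mul_pow, pow_mul, div_div, mul_comm]

/-- Summability of the even-index terms of `Li_s(x)` (`0 ≤ x < 1`): a subseries of the absolutely
convergent series `∑_k x^{k+1}/(k+1)^s`. [folklore] -/
private theorem ratParity_summable_even (s : ℕ) {x : ℝ} (hx : 0 ≤ x) (hx1 : x < 1) :
    Summable fun j : ℕ => x ^ (2 * j + 1) / (((2 * j : ℕ) : ℝ) + 1) ^ s :=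
  (DilogPade.summable_polylogSeries s hx hx1).comp_injective
    (i := fun j : ℕ => 2 * j) (mul_right_injective₀ two_ne_zero)

/-- Summability of the odd-index terms of `Li_s(x)` (`0 ≤ x < 1`): a subseries of the absolutely
convergent series `∑_k x^{k+1}/(k+1)^s`. [folklore] -/
private theorem ratParity_summable_odd (s : ℕ) {x : ℝ} (hx : 0 ≤ x) (hx1 : x < 1) :
    Summable fun j : ℕ => x ^ (2 * j + 1 + 1) / (((2 * j + 1 : ℕ) : ℝ) + 1) ^ s :=
  (DilogPade.summable_polylogSeries s hx hx1).comp_injective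
    (i := fun j : ℕ => 2 * j + 1)
    ((add_left_injective 1).comp (mul_right_injective₀ two_ne_zero))

/-- The even-index part of `Li_s(x)` is `x⁻¹ Θ_s(x²)` (`x ≠ 0`). [folklore] -/
private theorem ratParity_tsum_even (s : ℕ) {x : ℝ} (hx : x ≠ 0) :
    ∑' j : ℕ, x ^ (2 * j + 1) / (((2 * j : ℕ) : ℝ) + 1) ^ s =
      x⁻¹ * oddPolylogSeries s (x ^ 2) := by
  rw [oddPolylogSeries, ← tsum_mul_left]
  exact tsum_congr fun j => ratParity_term_even s hx j

/-- The odd-index part of `Li_s(x)` is `2^{-s} Li_s(x²)`. [folklore] -/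
private theorem ratParity_tsum_odd (s : ℕ) (x : ℝ) :
    ∑' j : ℕ, x ^ (2 * j + 1 + 1) / (((2 * j + 1 : ℕ) : ℝ) + 1) ^ s =
      DilogPade.polylogSeries s (x ^ 2) / 2 ^ s := by
  rw [DilogPade.polylogSeries, ← tsum_div_const]
  exact tsum_congr fun j => ratParity_term_odd s x j

/-- The parity bridge at a real point `0 < x < 1`:
`Li_s(x) = 2^{-s} Li_s(x²) + x⁻¹ Θ_s(x²)`. [folklore] -/
private theorem ratParity_polylogSeries_eq (s : ℕ) {x : ℝ} (hx : 0 < x) (hx1 : x < 1) :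
    DilogPade.polylogSeries s x =
      DilogPade.polylogSeries s (x ^ 2) / 2 ^ s + x⁻¹ * oddPolylogSeries s (x ^ 2) := by
  rw [← ratParity_tsum_odd s x, ← ratParity_tsum_even s hx.ne', add_comm, DilogPade.polylogSeries]
  exact (tsum_even_add_odd (f := fun k : ℕ => x ^ (k + 1) / ((k : ℝ) + 1) ^ s)
    (ratParity_summable_even s hx.le hx1) (ratParity_summable_odd s hx.le hx1)).symm

/-- The parity bridge at a real point `−x`, `0 < x < 1`:
`Li_s(−x) = 2^{-s} Li_s(x²) − x⁻¹ Θ_s(x²)`. [folklore] -/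
private theorem ratParity_polylogSeries_neg_eq (s : ℕ) {x : ℝ} (hx : 0 < x) (hx1 : x < 1) :
    DilogPade.polylogSeries s (-x) =
      DilogPade.polylogSeries s (x ^ 2) / 2 ^ s - x⁻¹ * oddPolylogSeries s (x ^ 2) := by
  have heven : ∀ j : ℕ, (-x) ^ (2 * j + 1) / (((2 * j : ℕ) : ℝ) + 1) ^ s =
      -(x ^ (2 * j + 1) / (((2 * j : ℕ) : ℝ) + 1) ^ s) := fun j => by
    rw [Odd.neg_pow (odd_two_mul_add_one j), neg_div]
  have hodd : ∀ j : ℕ, (-x) ^ (2 * j + 1 + 1) / (((2 * j + 1 : ℕ) : ℝ) + 1) ^ s =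
      x ^ (2 * j + 1 + 1) / (((2 * j + 1 : ℕ) : ℝ) + 1) ^ s := fun j => by
    rw [Even.neg_pow ⟨j + 1, by ring⟩]
  have he : Summable fun j : ℕ => (-x) ^ (2 * j + 1) / (((2 * j : ℕ) : ℝ) + 1) ^ s :=
    (ratParity_summable_even s hx.le hx1).neg.congr fun j => (heven j).symm
  have ho : Summable fun j : ℕ => (-x) ^ (2 * j + 1 + 1) / (((2 * j + 1 : ℕ) : ℝ) + 1) ^ s :=
    (ratParity_summable_odd s hx.le hx1).congr fun j => (hodd j).symm
  rw [sub_eq_add_neg, ← ratParity_tsum_odd s x, ← ratParity_tsum_even s hx.ne', ← tsum_neg,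
    ← tsum_congr hodd, ← tsum_congr heven, add_comm, DilogPade.polylogSeries]
  exact (tsum_even_add_odd (f := fun k : ℕ => (-x) ^ (k + 1) / ((k : ℝ) + 1) ^ s) he ho).symm

/-- **The parity bridge at `M/N`** (David–Hirata-Kohno–Kawashima 2020, the reduction behind the
two-point case of Thm 2.1 at rational points): for all naturals `1 ≤ M`, `2M ≤ N` and every `s`,
`Li_s(M/N) = 2^{-s} Li_s(M²/N²) + (N/M) Θ_s(M²/N²)`, where `Li_s = DilogPade.polylogSeries s` and
`Θ_s = oddPolylogSeries s` (split `∑_k (M/N)^{k+1}/(k+1)^s` into even and odd `k`).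
[cite: DavidHirataKohnoKawashima2020, Thm 2.1] -/
theorem polylogSeries_div_eq (s : ℕ) {M N : ℕ} (hM : 1 ≤ M) (hMN : 2 * M ≤ N) :
    DilogPade.polylogSeries s ((M : ℝ) / N) =
      DilogPade.polylogSeries s ((M : ℝ) ^ 2 / (N : ℝ) ^ 2) / 2 ^ s +
        ((N : ℝ) / M) * oddPolylogSeries s ((M : ℝ) ^ 2 / (N : ℝ) ^ 2) := by
  have hM0 : (0 : ℝ) < M := by exact_mod_cast hM
  have hN0 : (0 : ℝ) < N := by exact_mod_cast (show 0 < N by omega)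
  have hx1 : (M : ℝ) / N < 1 := by
    rw [div_lt_one hN0]
    exact_mod_cast (show M < N by omega)
  rw [ratParity_polylogSeries_eq s (div_pos hM0 hN0) hx1, inv_div, div_pow]

/-- **The parity bridge at `−M/N`** (David–Hirata-Kohno–Kawashima 2020, the reduction behind the
two-point case of Thm 2.1 at rational points): for all naturals `1 ≤ M`, `2M ≤ N` and every `s`,
`Li_s(−M/N) = 2^{-s} Li_s(M²/N²) − (N/M) Θ_s(M²/N²)`, where `Li_s = DilogPade.polylogSeries s` and
`Θ_s = oddPolylogSeries s` (the odd powers of `−M/N` change sign, the even ones do not).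
[cite: DavidHirataKohnoKawashima2020, Thm 2.1] -/
theorem polylogSeries_neg_div_eq (s : ℕ) {M N : ℕ} (hM : 1 ≤ M) (hMN : 2 * M ≤ N) :
    DilogPade.polylogSeries s (-((M : ℝ) / N)) =
      DilogPade.polylogSeries s ((M : ℝ) ^ 2 / (N : ℝ) ^ 2) / 2 ^ s -
        ((N : ℝ) / M) * oddPolylogSeries s ((M : ℝ) ^ 2 / (N : ℝ) ^ 2) := by
  have hM0 : (0 : ℝ) < M := by exact_mod_cast hM
  have hN0 : (0 : ℝ) < N := by exact_mod_cast (show 0 < N by omega)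
  have hx1 : (M : ℝ) / N < 1 := by
    rw [div_lt_one hN0]
    exact_mod_cast (show M < N by omega)
  rw [ratParity_polylogSeries_neg_eq s (div_pos hM0 hN0) hx1, inv_div, div_pow]

end ParityPade

open ParityPade

/-- **Linear independence of `1, Li_s(M/N), Li_s(−M/N)` (`1 ≤ s ≤ w`) over `ℚ`** for `w ≥ 1`,
`M ≥ 1` and `log N ≥ 4(w+1)³ + 4 w log M`: every rational relation
`a + ∑_{j<w} b_j Li_{j+1}(M/N) + ∑_{j<w} c_j Li_{j+1}(−M/N) = 0` is trivial
(David–Hirata-Kohno–Kawashima 2020, Thm 2.1 at the two rational points `±M/N`, crude threshold).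
[cite: DavidHirataKohnoKawashima2020, Thm 2.1] -/
theorem one_polylog_twoPoints_linearIndependent_rat (w : ℕ) (hw : 1 ≤ w) (M N : ℕ) (hM : 1 ≤ M)
    (hN : 4 * ((w : ℝ) + 1) ^ 3 + 4 * w * Real.log M ≤ Real.log N) (a : ℚ) (b c : Fin w → ℚ)
    (h : (a : ℝ) + ∑ j : Fin w, (b j : ℝ) * DilogPade.polylogSeries ((j : ℕ) + 1) ((M : ℝ) / N) +
      ∑ j : Fin w, (c j : ℝ) * DilogPade.polylogSeries ((j : ℕ) + 1) (-((M : ℝ) / N)) = 0) :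
    a = 0 ∧ b = 0 ∧ c = 0 := by
  -- `N ≥ 2M`
  have hw1 : (1 : ℝ) ≤ w := by exact_mod_cast hw
  have hM1 : (1 : ℝ) ≤ M := by exact_mod_cast hM
  have hMpos : (0 : ℝ) < M := by positivity
  have hlogM : 0 ≤ Real.log M := Real.log_nonneg hM1
  have hwlogM : Real.log M ≤ 4 * w * Real.log M := by nlinarith
  have hL : (32 : ℝ) + Real.log M ≤ Real.log N := by
    calc (32 : ℝ) + Real.log M = 4 * 2 ^ 3 + Real.log M := by norm_num
      _ ≤ 4 * ((w : ℝ) + 1) ^ 3 + 4 * w * Real.log M := by gcongr; linarith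
      _ ≤ Real.log N := hN
  have hN0 : (N : ℝ) ≠ 0 := by
    intro h0; rw [h0, Real.log_zero] at hL; linarith
  have hNpos : (0 : ℝ) < N := lt_of_le_of_ne (Nat.cast_nonneg N) (Ne.symm hN0)
  have h2MR : (2 : ℝ) * M ≤ N := by
    have hlog2 : Real.log 2 ≤ 2 - 1 := Real.log_le_sub_one_of_pos two_pos
    have h2M : Real.log (2 * M) ≤ Real.log N := by
      rw [Real.log_mul two_ne_zero hMpos.ne']
      linarith
    exact (Real.log_le_log_iff (by positivity) hNpos).1 h2M
  have h2M : 2 * M ≤ N := by exact_mod_cast h2MR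
  -- `a = M²`, `b = N²`, `log N² = 2 log N ≥ 8(w+1)³ + 4w log M²`
  have hM2 : 1 ≤ M ^ 2 := Nat.one_le_pow _ _ hM
  have hb : 8 * ((w : ℝ) + 1) ^ 3 + 4 * w * Real.log ((M ^ 2 : ℕ) : ℝ) ≤
      Real.log ((N ^ 2 : ℕ) : ℝ) := by
    push_cast
    rw [Real.log_pow, Real.log_pow]
    push_cast
    nlinarith
  have hcast : ((M : ℝ) ^ 2 / (N : ℝ) ^ 2) = ((M ^ 2 : ℕ) : ℝ) / ((N ^ 2 : ℕ) : ℝ) := by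
    push_cast; ring
  -- rewrite the relation through the parity bridge
  have h' : (a : ℝ) +
      ∑ j : Fin w, (((b j + c j) / 2 ^ ((j : ℕ) + 1) : ℚ) : ℝ) *
        DilogPade.polylogSeries ((j : ℕ) + 1) (((M ^ 2 : ℕ) : ℝ) / ((N ^ 2 : ℕ) : ℝ)) +
      ∑ j : Fin w, (((b j - c j) * N / M : ℚ) : ℝ) *
        oddPolylogSeries ((j : ℕ) + 1) (((M ^ 2 : ℕ) : ℝ) / ((N ^ 2 : ℕ) : ℝ)) = 0 := by
    rw [← h, ← hcast]
    have e : ∀ j : Fin w,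
        (b j : ℝ) * DilogPade.polylogSeries ((j : ℕ) + 1) ((M : ℝ) / N) +
          (c j : ℝ) * DilogPade.polylogSeries ((j : ℕ) + 1) (-((M : ℝ) / N)) =
        (((b j + c j) / 2 ^ ((j : ℕ) + 1) : ℚ) : ℝ) *
            DilogPade.polylogSeries ((j : ℕ) + 1) ((M : ℝ) ^ 2 / (N : ℝ) ^ 2) +
          (((b j - c j) * N / M : ℚ) : ℝ) *
            oddPolylogSeries ((j : ℕ) + 1) ((M : ℝ) ^ 2 / (N : ℝ) ^ 2) := by
      intro j
      rw [polylogSeries_div_eq _ hM h2M, polylogSeries_neg_div_eq _ hM h2M]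
      push_cast
      ring
    rw [add_assoc, add_assoc, ← Finset.sum_add_distrib, ← Finset.sum_add_distrib]
    congr 1
    exact Finset.sum_congr rfl fun j _ => (e j).symm
  obtain ⟨ha, hb, hc⟩ :=
    one_polylog_oddPolylog_linearIndependent_rat w hw (M ^ 2) (N ^ 2) hM2 hb a _ _ h'
  have hNQ : (N : ℚ) ≠ 0 := by exact_mod_cast (show N ≠ 0 by omega)
  have hMQ : (M : ℚ) ≠ 0 := by exact_mod_cast (show M ≠ 0 by omega)
  have hbc : ∀ j, b j + c j = 0 ∧ b j - c j = 0 := by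
    intro j
    have h1 := congrFun hb j
    have h2 := congrFun hc j
    simp only [Pi.zero_apply, div_eq_zero_iff, pow_eq_zero_iff', OfNat.ofNat_ne_zero, ne_eq,
      false_and, or_false, mul_eq_zero, hNQ, hMQ] at h1 h2
    exact ⟨h1, h2⟩
  refine ⟨ha, ?_, ?_⟩
  · funext j
    have := hbc j
    simp only [Pi.zero_apply]
    linarith [this.1, this.2]
  · funext j
    have := hbc j
    simp only [Pi.zero_apply]
    linarith [this.1, this.2]

end Literature.NumberTheory.DiophantineApproximation
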